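import Summits.Ventures.PercRepro.CountNAN3
import Summits.Ventures.PercRepro.SMC

/-!
# PercRepro — C-021 «ORBIT-2» and C-022 «ORBIT-4»: mine-2's per-interval count inequalities (typer-2, gen 5)

`conjectures/C-021.md` (lead 09:12:53Z, ranked 22 at 09:30:11Z) and `conjectures/C-022.md` (09:42:15Z,
provisional 18): for a multigraph with marks `m` and a pair of DISJOINT edge sets `I, D` — here configurations
`I ⊓ D = ⊥` — the interval `[I, I ⊔ D]` of the cube is the set of `I ⊔ A`, `A ≤ D`; with
`N(ω)` = the number of mark-classes of the open graph `ω` (`markClasses`), the interval counts are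
`c_j = #{A ≤ D : N(I ⊔ A) = j}` (`intervalCount`) and the antipodal counts
`a_ij = #{A ≤ D : N(I ⊔ A) = i ∧ N(I ⊔ (D ⊓ Aᶜ)) = j}` (`antipodalCount`; `D ⊓ Aᶜ = D ∖ A`).

* **`MultiGraph.Orbit2 a b c I D`** — C-021 on one interval: `2·a₁₃ ≤ c₂` (three marks);
  **`Orbit2All`** — for every interval with `N(I) = 3` and `N(I ⊔ D) = 1`; **`C021`** — every finite
  multigraph, every three marks; **`C021Prob`** — its probability form (ii), `2·T·B ≤ P1 + P2 + P3` at all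
  weights. Constant 2 is sharp (the 2-path core; `orbit2_path2` decided).
* **`MultiGraph.Orbit4 a b c d I D`** — C-022 on one interval: `(Q13) 2·c₂ ≥ 3·a₁₃`, `(Q24) 2·c₃ ≥ 3·a₂₄`,
  `(Q14) c₂ + c₃ ≥ 6·a₁₄` (four marks); **`Orbit4All`** — for every interval with `N(I) ≥ 3` and
  `N(I ⊔ D) ≤ 2`; **`C022`**. Constants sharp at `C₄` (all four marked; `orbit4_cycle4` decided on the full
  interval), `K_{1,4}`, the 3-path (the all-interval instance `Orbit4All` of `cycle4` exceeds the default heartbeats under `decide`; not stated).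

Evidence of record (exact): C-021 — every orbit of every graph `n ≤ 5` (all `m`), `n = 6` (`m ≤ 12`), `n = 7`
(`m ≤ 12`, 747.7 M orbits), `n = 8` (`m ≤ 11`, 2.41 G orbits) × all 3-markings, two seats (mine-2 j157243,
engine j157814, identical counts), 0 violations, min ratio exactly 2; C-022 — engine orbit4.c, all graphs
`n ≤ 6` all `m` × all 4-markings (89,365,230 orbits), 0 violations on 76.1 M / 5.1 M / 14.5 M cases, planted
controls fire. All statements are pure `ℕ` counts (no reals), decidable on finite data.
-/

namespace PercRepro

open Finset

namespace MultiGraph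

variable {V E : Type*} (G : MultiGraph V E) [DecidableEq V] [Fintype V] [Fintype E] [DecidableEq E]

/-- `N(ω)`: the number of mark-classes of the open graph `ω` (distinct connectivity classes among the marks
`m`, each class read as its set of indices). -/
def markClasses (ω : Config E) {k : ℕ} (m : Fin k → V) : ℕ :=
  (univ.image fun i : Fin k => univ.filter fun j : Fin k => G.Conn ω (m i) (m j)).card

/-- `c_j` of the interval `[I, I ⊔ D]`: the number of `A ≤ D` with `N(I ⊔ A) = j`. -/
def intervalCount {k : ℕ} (m : Fin k → V) (I D : Config E) (j : ℕ) : ℕ :=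
  (univ.filter fun A : Config E => A ≤ D ∧ G.markClasses (I ⊔ A) m = j).card

/-- `a_ij` of the interval `[I, I ⊔ D]`: the antipodal `(i, j)` pairs — `A ≤ D` with `N(I ⊔ A) = i` and
`N(I ⊔ (D ⊓ Aᶜ)) = j` (`D ⊓ Aᶜ` is the complement `D ∖ A` of `A` in `D`). -/
def antipodalCount {k : ℕ} (m : Fin k → V) (I D : Config E) (i j : ℕ) : ℕ :=
  (univ.filter fun A : Config E =>
    A ≤ D ∧ G.markClasses (I ⊔ A) m = i ∧ G.markClasses (I ⊔ (D ⊓ Aᶜ)) m = j).card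

/-- **ORBIT-2 on one interval** (C-021, mine-2 row M2-9): `#{A ⊆ D : N(I ∪ A) = 2} ≥ 2·#{A ⊆ D : N(I ∪ A) = 1
∧ N(I ∪ (D ∖ A)) = 3}`. -/
def Orbit2 (a b c : V) (I D : Config E) : Prop :=
  2 * G.antipodalCount ![a, b, c] I D 1 3 ≤ G.intervalCount ![a, b, c] I D 2

/-- `Orbit2` is decidable on finite data. -/
instance (a b c : V) (I D : Config E) : Decidable (G.Orbit2 a b c I D) := by
  unfold Orbit2; infer_instance

/-- **ORBIT-2 for one marked multigraph**: every interval `[I, I ⊔ D]` (`I ⊓ D = ⊥`) with `N(I) = 3` and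
`N(I ⊔ D) = 1`. -/
def Orbit2All (a b c : V) : Prop :=
  ∀ I D : Config E, I ⊓ D = ⊥ → G.markClasses I ![a, b, c] = 3 → G.markClasses (I ⊔ D) ![a, b, c] = 1 →
    G.Orbit2 a b c I D

/-- `Orbit2All` is decidable on finite data. -/
instance (a b c : V) : Decidable (G.Orbit2All a b c) := by
  unfold Orbit2All; infer_instance

/-- **ORBIT-4 on one interval** (C-022, mine-2's `k = 4` per-orbit constants): with `c_j`, `a_ij` as above,
`(Q13) 2·c₂ ≥ 3·a₁₃`, `(Q24) 2·c₃ ≥ 3·a₂₄`, `(Q14) c₂ + c₃ ≥ 6·a₁₄`. -/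
def Orbit4 (a b c d : V) (I D : Config E) : Prop :=
  2 * G.intervalCount ![a, b, c, d] I D 2 ≥ 3 * G.antipodalCount ![a, b, c, d] I D 1 3 ∧
    2 * G.intervalCount ![a, b, c, d] I D 3 ≥ 3 * G.antipodalCount ![a, b, c, d] I D 2 4 ∧
      G.intervalCount ![a, b, c, d] I D 2 + G.intervalCount ![a, b, c, d] I D 3 ≥
        6 * G.antipodalCount ![a, b, c, d] I D 1 4

/-- `Orbit4` is decidable on finite data. -/
instance (a b c d : V) (I D : Config E) : Decidable (G.Orbit4 a b c d I D) := by
  unfold Orbit4; infer_instance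

/-- **ORBIT-4 for one marked multigraph**: every interval `[I, I ⊔ D]` (`I ⊓ D = ⊥`) with `N(I) ≥ 3` and
`N(I ⊔ D) ≤ 2`. -/
def Orbit4All (a b c d : V) : Prop :=
  ∀ I D : Config E, I ⊓ D = ⊥ → 3 ≤ G.markClasses I ![a, b, c, d] → G.markClasses (I ⊔ D) ![a, b, c, d] ≤ 2 →
    G.Orbit4 a b c d I D

/-- `Orbit4All` is decidable on finite data. -/
instance (a b c d : V) : Decidable (G.Orbit4All a b c d) := by
  unfold Orbit4All; infer_instance

end MultiGraph

/-- **C-021 = ORBIT-2** (mine-2 row M2-9; CONJECTURES v49, ranked 22): every finite multigraph, every three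
marks, every interval with `N(I) = 3`, `N(I ∪ D) = 1`. -/
def C021 : Prop :=
  ∀ {V E : Type} [DecidableEq V] [Fintype V] [Fintype E] [DecidableEq E] (G : MultiGraph V E)
    (a b c : V), G.Orbit2All a b c

/-- **C-021, probability form (ii)** (`conjectures/C-021.md`; NAN₂ at ALL edge weights): `2·P(abc)·P(a|b|c) ≤
P(exactly one pair)` — on the engine's `k = 3` rows (`law3`: `0 = abc`, `1 = ab|c`, `2 = ac|b`, `3 = a|bc`,
`4 = a|b|c`), `2·T·B ≤ P1 + P2 + P3` for every finite multigraph, every `p ∈ [0,1]^E`, every `a, b, c`. The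
constant-1 form is p5's theorem `c021_const_one` (from GZ24 eq. (final)); the per-interval `C021` implies this
form by mine-2's hierarchy (per orbit ⇒ multivariate ⇒ all weights). -/
def C021Prob : Prop :=
  ∀ {V E : Type} [Fintype E] [DecidableEq E] (G : MultiGraph V E) (p : E → ℝ), IsProb p →
    ∀ a b c : V,
      2 * (G.law3 p a b c 0 * G.law3 p a b c 4) ≤ G.law3 p a b c 1 + G.law3 p a b c 2 + G.law3 p a b c 3

/-- **C-022 = ORBIT-4** (mine-2's `k = 4` per-orbit constants; CONJECTURES v52, provisional 18): every finite
multigraph, every four marks, every interval with `N(I) ≥ 3`, `N(I ∪ D) ≤ 2`. -/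
def C022 : Prop :=
  ∀ {V E : Type} [DecidableEq V] [Fintype V] [Fintype E] [DecidableEq E] (G : MultiGraph V E)
    (a b c d : V), G.Orbit4All a b c d

/-- The tight instance of ORBIT-2: the 2-path `0 — 1 — 2` (typer-1's `path2`) on its full interval
`[⊥, ⊤]` — `c₂ = 2` (one edge open), `a₁₃ = 1` (`A = D`): ratio exactly 2. Decided. -/
theorem orbit2_path2 : Examples.path2.Orbit2 0 1 2 ⊥ ⊤ := by decide

/-- … and it is TIGHT there: `2·a₁₃ = c₂` (`2·1 = 2`). Decided. -/
theorem orbit2_path2_tight :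
    2 * Examples.path2.antipodalCount ![0, 1, 2] ⊥ ⊤ 1 3 = Examples.path2.intervalCount ![0, 1, 2] ⊥ ⊤ 2 := by
  decide

/-- ORBIT-2 holds on every interval of the 2-path. Decided. -/
theorem orbit2All_path2 : Examples.path2.Orbit2All 0 1 2 := by decide

/-- ORBIT-2 holds on every interval of the marked triangle. Decided. -/
theorem orbit2All_triangle : Examples.triangle.Orbit2All 0 1 2 := by decide

/-- ORBIT-2 holds on every interval of the 4-cycle with marks `0, 1, 2` (256 intervals). Decided. -/
theorem orbit2All_cycle4 : Examples.cycle4.Orbit2All 0 1 2 := by decide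

/-- A tight instance of ORBIT-4: the 4-cycle with all four vertices marked (typer-1's `cycle4`), full interval
`[⊥, ⊤]`. Decided. -/
theorem orbit4_cycle4 : Examples.cycle4.Orbit4 0 1 2 3 ⊥ ⊤ := by decide

/-- … and `(Q13)` is TIGHT there: `2·c₂ = 3·a₁₃` on the full interval of the all-marked 4-cycle. Decided. -/
theorem orbit4_cycle4_tight :
    2 * Examples.cycle4.intervalCount ![0, 1, 2, 3] ⊥ ⊤ 2 =
      3 * Examples.cycle4.antipodalCount ![0, 1, 2, 3] ⊥ ⊤ 1 3 := by
  decide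

end PercRepro
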